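import Mathlib
import Literature.Computability.AlgebraicComplexity.NestFreeMatchingPoly
import Literature.Computability.AlgebraicComplexity.MonotoneStructureHomogeneous
import Summits.ValiantsHypothesis.ValiantsHypothesis.Theses.FifoMatching
import HarnessLib

/-!
# Route `FifoMatching`, crux `NNMonotoneHard` (stmt-ValiantsHypothesis-11617): reduction of the
# monotone lower bound for `NN_n` to a measure lemma on balanced vertex splits

`NNMonotoneHard` says that the nest-free (FIFO) matching polynomials
`NN_n = Σ_{M nest-free perfect matching of [2n]} Π_{i < M i} x_{i, M i}` over the semiring `ℝ≥0`
are not p-computable, i.e. monotone (fan-in-two, weighted) circuits for `NN_n` have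
superpolynomial size.  This file proves the DEFINITION-FREE half of the intended proof:

* `respects_and_compl_of_add_eq_arcExponent`, `card_verts_eq_two_mul_degree` — bookkeeping of
  sub-matchings: if `g + h` is the arc set of a perfect matching `M`, the vertex set of `g` is a
  union of arcs of `M`, complementary to the vertex set of `h`, of size `2 · deg g`;
* `exists_balanced_vertex_split` — **balanced products live on one vertex split**: if `a` is
  homogeneous of degree `d`, `a · b ≠ 0` and `a · b ≤ Σ_{M ∈ 𝓕} x^M` coefficientwise for a
  family `𝓕` of perfect matchings, then there is ONE set `S` of `2d` points such that every
  monomial of `a · b` is the arc set of some `M ∈ 𝓕` that RESPECTS `S`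
  (`∀ i, i ∈ S ↔ M i ∈ S`: no arc of `M` joins `S` to its complement);
* `exists_balanced_split_of_complexity` — **the union bound**: by the homogeneous structure
  theorem (`exists_homogeneous_balanced_decomposition_of_complexity_le`), for every weighting
  `μ ≥ 0` of the nest-free perfect matchings of `[2n]` (`n ≥ 3`) with total mass `1` there is a
  balanced set `S` (`2n < 3|S| ≤ 4n`) with
  `1 ≤ 4 · L(NN_n) · (n+1)² · μ{M : M respects S}`;
* `nnMonotoneHard_of_spread_measures` — hence `NNMonotoneHard` follows from the existence, for
  every exponent `c`, of some `n ≥ 3` and a probability weighting of the nest-free perfect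
  matchings of `[2n]` under which every balanced split is respected with mass
  `< 1 / (4 (n^c + c) (n+1)²)` (the crux's remaining COMBINATORIAL content, registered as the
  stub of line `drift-measure` under `Cruxes/NNMonotoneHard/`).

Why this is the right cut: for the uniform weighting the interval split `S = [0, 2d)` is
respected with mass `C_d C_{n-d} / C_n = Θ(n^{-3/2})` only (the route's "Catalan-mass
rectangles": Jerrum–Snir counting cannot work), and for interval splits the set of respecting
matchings IS a full product set, so no finer rectangle property helps; a non-uniform ("drift")
measure is needed exactly for the statement isolated here.

Honest framing: a reduction between statements about ONE candidate family; `NNMonotoneHard` is a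
monotone lower bound (consistency check / kill switch of the route), and VP ≠ VNP is not moved
by anything in this file.  No definitions, no named facts.
-/

noncomputable section

-- Sub = Summit single-conjunct layout: the duplicated namespace component is mandated by the tree.
set_option linter.dupNamespace false

namespace Summit.ValiantsHypothesis.ValiantsHypothesis.Theorems.FifoMatching.NNMonotoneHard

open MvPolynomial Finset Literature.Computability.AlgebraicComplexity
open scoped NNReal

variable {m : ℕ}

/-! ### Sub-matchings of a perfect matching -/

/-- If `g + h` is the arc set of `M`, then `g` vanishes off the arcs `(i, M i)`, `i < M i`, of `M`.
[folklore] -/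
theorem apply_eq_zero_of_add_eq_arcExponent {M : Fin m → Fin m} {g h : (Fin m × Fin m) →₀ ℕ}
    (hgh : g + h = arcExponent M) {i j : Fin m} (hij : ¬ (i < M i ∧ M i = j)) : g (i, j) = 0 := by
  have e := congrArg (fun f => f (i, j)) hgh
  simp only [Finsupp.coe_add, Pi.add_apply, arcExponent_apply, if_neg hij] at e
  omega

/-- If `g + h` is the arc set of `M`, then on an arc of `M` the values of `g` and `h` add up to
`1`. [folklore] -/
theorem apply_add_apply_eq_one_of_add_eq_arcExponent {M : Fin m → Fin m}
    {g h : (Fin m × Fin m) →₀ ℕ} (hgh : g + h = arcExponent M) {i : Fin m} (hi : i < M i) :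
    g (i, M i) + h (i, M i) = 1 := by
  simpa [Finsupp.coe_add, Pi.add_apply, arcExponent_apply, hi] using
    congrArg (fun f => f (i, M i)) hgh

/-- The vertex predicate of a sub-arc-set `g` of a perfect matching `M` at an opener `i`:
`i` is a vertex of `g` iff the arc `(i, M i)` belongs to `g`. [folklore] -/
theorem isVertex_iff_of_lt {M : Fin m → Fin m} (hM : M ∈ perfectMatchings m)
    {g h : (Fin m × Fin m) →₀ ℕ} (hgh : g + h = arcExponent M) {i : Fin m} (hi : i < M i) :
    (∃ j, g (i, j) ≠ 0 ∨ g (j, i) ≠ 0) ↔ g (i, M i) ≠ 0 := by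
  obtain ⟨hinv, -⟩ := mem_perfectMatchings.1 hM
  constructor
  · rintro ⟨j, hj | hj⟩
    · by_cases h : i < M i ∧ M i = j
      · rw [← h.2] at hj; exact hj
      · exact absurd (apply_eq_zero_of_add_eq_arcExponent hgh h) hj
    · by_cases h : j < M j ∧ M j = i
      · exfalso
        have : M i = j := by rw [← h.2, hinv]
        rw [this] at hi
        exact lt_asymm hi (h.2 ▸ h.1)
      · exact absurd (apply_eq_zero_of_add_eq_arcExponent hgh h) hj
  · intro h
    exact ⟨M i, Or.inl h⟩

/-- The vertex predicate at a closer `i` (`M i < i`): `i` is a vertex of `g` iff the arc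
`(M i, i)` belongs to `g`. [folklore] -/
theorem isVertex_iff_of_gt {M : Fin m → Fin m} (hM : M ∈ perfectMatchings m)
    {g h : (Fin m × Fin m) →₀ ℕ} (hgh : g + h = arcExponent M) {i : Fin m} (hi : M i < i) :
    (∃ j, g (i, j) ≠ 0 ∨ g (j, i) ≠ 0) ↔ g (M i, i) ≠ 0 := by
  obtain ⟨hinv, -⟩ := mem_perfectMatchings.1 hM
  constructor
  · rintro ⟨j, hj | hj⟩
    · by_cases h : i < M i ∧ M i = j
      · exact absurd hi (lt_asymm h.1)
      · exact absurd (apply_eq_zero_of_add_eq_arcExponent hgh h) hj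
    · by_cases h : j < M j ∧ M j = i
      · have : M i = j := by rw [← h.2, hinv]
        rw [this]; exact hj
      · exact absurd (apply_eq_zero_of_add_eq_arcExponent hgh h) hj
  · intro h
    exact ⟨M i, Or.inr h⟩

/-- **A sub-arc-set of a perfect matching spans a union of arcs, complementary to its partner.**
If `g + h` is the arc set of a perfect matching `M` and `V` is the vertex set of `g`, then
`M` respects `V` (`i ∈ V ↔ M i ∈ V`) and `V` is the complement of the vertex set of `h`.
[folklore] -/
theorem respects_and_compl_of_add_eq_arcExponent {M : Fin m → Fin m}
    (hM : M ∈ perfectMatchings m) {g h : (Fin m × Fin m) →₀ ℕ} (hgh : g + h = arcExponent M)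
    (V : Finset (Fin m)) (hV : ∀ i, i ∈ V ↔ ∃ j, g (i, j) ≠ 0 ∨ g (j, i) ≠ 0) :
    (∀ i, i ∈ V ↔ M i ∈ V) ∧ ∀ i, i ∈ V ↔ ¬ ∃ j, h (i, j) ≠ 0 ∨ h (j, i) ≠ 0 := by
  obtain ⟨hinv, hfp⟩ := mem_perfectMatchings.1 hM
  have hhg : h + g = arcExponent M := by rw [add_comm]; exact hgh
  refine ⟨fun i => ?_, fun i => ?_⟩
  · rcases lt_or_gt_of_ne (hfp i).symm with hi | hi
    · have hi' : M (M i) < M i := by rw [hinv]; exact hi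
      rw [hV, hV, isVertex_iff_of_lt hM hgh hi, isVertex_iff_of_gt hM hgh hi', hinv]
    · have hi' : M i < M (M i) := by rw [hinv]; exact hi
      rw [hV, hV, isVertex_iff_of_gt hM hgh hi, isVertex_iff_of_lt hM hgh hi', hinv]
  · rcases lt_or_gt_of_ne (hfp i).symm with hi | hi
    · rw [hV, isVertex_iff_of_lt hM hgh hi, isVertex_iff_of_lt hM hhg hi]
      have := apply_add_apply_eq_one_of_add_eq_arcExponent hgh hi
      omega
    · rw [hV, isVertex_iff_of_gt hM hgh hi, isVertex_iff_of_gt hM hhg hi]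
      have hlt : M i < M (M i) := by rwa [hinv]
      have := apply_add_apply_eq_one_of_add_eq_arcExponent hgh hlt
      rw [hinv] at this
      omega

/-- **The vertex set of a sub-arc-set `g` of a perfect matching has `2 · deg g` points** (each of
its arcs contributes its two endpoints, and the arcs of a matching are disjoint). [folklore] -/
theorem card_verts_eq_two_mul_degree {M : Fin m → Fin m} (hM : M ∈ perfectMatchings m)
    {g h : (Fin m × Fin m) →₀ ℕ} (hgh : g + h = arcExponent M)
    (V : Finset (Fin m)) (hV : ∀ i, i ∈ V ↔ ∃ j, g (i, j) ≠ 0 ∨ g (j, i) ≠ 0) :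
    V.card = 2 * g.degree := by
  classical
  obtain ⟨hinv, hfp⟩ := mem_perfectMatchings.1 hM
  -- the openers of the arcs of `g`
  set O : Finset (Fin m) := univ.filter fun i => i < M i ∧ g (i, M i) ≠ 0 with hO
  have hMinj : Function.Injective M := fun i j hij => by rw [← hinv i, hij, hinv]
  -- `V = O ∪ M '' O`, disjointly
  have hVeq : V = O ∪ O.image M := by
    ext i
    rw [mem_union, mem_image, hV]
    simp only [hO, mem_filter, mem_univ, true_and]
    rcases lt_or_gt_of_ne (hfp i).symm with hi | hi
    · rw [isVertex_iff_of_lt hM hgh hi]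
      constructor
      · intro h; exact Or.inl ⟨hi, h⟩
      · rintro (⟨-, h⟩ | ⟨j, ⟨hj, -⟩, rfl⟩)
        · exact h
        · exfalso; rw [hinv] at hi; exact lt_asymm hi hj
    · rw [isVertex_iff_of_gt hM hgh hi]
      constructor
      · intro h
        refine Or.inr ⟨M i, ⟨?_, ?_⟩, hinv i⟩
        · rwa [hinv]
        · rwa [hinv]
      · rintro (⟨h, -⟩ | ⟨j, ⟨-, hj⟩, rfl⟩)
        · exact absurd hi (lt_asymm h)
        · rwa [hinv]
  have hdisj : Disjoint O (O.image M) := by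
    rw [disjoint_left]
    intro i hi hi'
    simp only [hO, mem_filter, mem_univ, true_and, mem_image] at hi hi'
    obtain ⟨j, ⟨hj, -⟩, rfl⟩ := hi'
    rw [hinv] at hi
    exact lt_asymm hj hi.1
  have hcardV : V.card = 2 * O.card := by
    rw [hVeq, card_union_of_disjoint hdisj, card_image_of_injective _ hMinj]
    ring
  -- `deg g = |O|`: the support of `g` is `{(i, M i) : i ∈ O}` and `g = 1` there
  have hsupp : g.support = O.image fun i => (i, M i) := by
    ext ⟨i, j⟩
    simp only [Finsupp.mem_support_iff, mem_image, hO, mem_filter, mem_univ, true_and,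
      Prod.mk.injEq]
    constructor
    · intro hg
      by_cases h : i < M i ∧ M i = j
      · refine ⟨i, ⟨h.1, ?_⟩, rfl, h.2⟩
        rw [h.2]; exact hg
      · exact absurd (apply_eq_zero_of_add_eq_arcExponent hgh h) hg
    · rintro ⟨i', ⟨hi', hg⟩, rfl, rfl⟩
      exact hg
  have hone : ∀ x ∈ g.support, g x = 1 := by
    intro x hx
    rw [hsupp, mem_image] at hx
    obtain ⟨i, hi, rfl⟩ := hx
    simp only [hO, mem_filter, mem_univ, true_and] at hi
    have := apply_add_apply_eq_one_of_add_eq_arcExponent hgh hi.1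
    omega
  have hdeg : g.degree = O.card := by
    rw [Finsupp.degree_apply, sum_congr rfl hone, sum_const, smul_eq_mul, mul_one, hsupp,
      card_image_of_injective]
    intro i j hij
    exact (Prod.mk.injEq _ _ _ _ ▸ hij).1
  rw [hcardV, hdeg]

/-! ### Balanced products live on one vertex split -/

/-- Over `ℝ≥0` there is no cancellation: the sum of a monomial of `f` and a monomial of `g` is a
monomial of `f * g` (restated from `MonotoneStructure.add_mem_support_mul` for the variable type
`Fin m × Fin m`). [folklore] -/
theorem add_mem_support_mul' {f g : MvPolynomial (Fin m × Fin m) ℝ≥0}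
    {x y : (Fin m × Fin m) →₀ ℕ} (hx : x ∈ f.support) (hy : y ∈ g.support) :
    x + y ∈ (f * g).support :=
  add_mem_support_mul hx hy

/-- **Balanced products live on one vertex split.** Let `𝓕` be a family of perfect matchings of
`Fin m` and `p = Σ_{M ∈ 𝓕} x^M` its arc polynomial over `ℝ≥0`. If `a` is homogeneous of degree
`d`, `a · b ≠ 0` and `a · b ≤ p` coefficientwise, then there is a set `S` of `2d` points such
that every monomial of `a · b` is the arc set of a member of `𝓕` respecting `S`. Proof: fix a
monomial `h₀` of `b`; for every monomial `g` of `a`, `g + h₀` is a monomial of `a b ≤ p`, hence a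
perfect matching, so the vertex set of `g` is the complement `S` of that of `h₀`; a monomial
`g + h` of `a b` is a matching `M ∈ 𝓕` and `M` respects the vertex set `S` of `g`. [folklore] -/
theorem exists_balanced_vertex_split {𝓕 : Finset (Fin m → Fin m)} (h𝓕 : 𝓕 ⊆ perfectMatchings m)
    {a b : MvPolynomial (Fin m × Fin m) ℝ≥0} {d : ℕ} (ha : a.IsHomogeneous d) (hab : a * b ≠ 0)
    (hle : ∀ x, coeff x (a * b) ≤ coeff x (∑ M ∈ 𝓕, arcMonomial ℝ≥0 M)) :
    ∃ S : Finset (Fin m), S.card = 2 * d ∧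
      ∀ x ∈ (a * b).support, ∃ M ∈ 𝓕, arcExponent M = x ∧ ∀ i, i ∈ S ↔ M i ∈ S := by
  classical
  -- every monomial below `p` is the arc set of a member of `𝓕`
  have hmem : ∀ x ∈ (a * b).support, ∃ M ∈ 𝓕, arcExponent M = x := by
    intro x hx
    have hx' : x ∈ (∑ M ∈ 𝓕, arcMonomial ℝ≥0 M).support := by
      rw [mem_support_iff] at hx ⊢
      exact fun h0 => hx (le_antisymm ((hle x).trans h0.le) zero_le)
    rw [support_sum_arcMonomial h𝓕, mem_image] at hx'
    exact hx'
  have hb : b ≠ 0 := fun h => hab (by rw [h, mul_zero])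
  obtain ⟨h₀, hh₀⟩ := support_nonempty.2 hb
  -- the split: the complement of the vertex set of `h₀`
  set S : Finset (Fin m) := univ.filter fun i => ¬ ∃ j, h₀ (i, j) ≠ 0 ∨ h₀ (j, i) ≠ 0 with hS
  -- the vertex set of every monomial of `a` is `S`
  have hverts : ∀ g ∈ a.support, ∀ i, i ∈ S ↔ ∃ j, g (i, j) ≠ 0 ∨ g (j, i) ≠ 0 := by
    intro g hg i
    obtain ⟨M₀, hM₀, hM₀x⟩ := hmem _ (add_mem_support_mul' hg hh₀)
    set V : Finset (Fin m) := univ.filter fun i => ∃ j, g (i, j) ≠ 0 ∨ g (j, i) ≠ 0 with hV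
    have hV' : ∀ i, i ∈ V ↔ ∃ j, g (i, j) ≠ 0 ∨ g (j, i) ≠ 0 := fun i => by simp [hV]
    have key := (respects_and_compl_of_add_eq_arcExponent (h𝓕 hM₀) hM₀x.symm V hV').2 i
    rw [← hV', key, hS]
    simp
  refine ⟨S, ?_, ?_⟩
  · -- `|S| = 2d`, computed on any monomial of `a`
    have ha0 : a ≠ 0 := fun h => hab (by rw [h, zero_mul])
    obtain ⟨g, hg⟩ := support_nonempty.2 ha0
    obtain ⟨M₀, hM₀, hM₀x⟩ := hmem _ (add_mem_support_mul' hg hh₀)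
    rw [card_verts_eq_two_mul_degree (h𝓕 hM₀) hM₀x.symm S (hverts g hg)]
    have hdeg : g.degree = d := by
      have := ha (mem_support_iff.1 hg)
      rw [Finsupp.degree_eq_weight_one]
      exact this
    rw [hdeg]
  · intro x hx
    obtain ⟨g, hg, h, hh, rfl⟩ := Finset.mem_add.1 (support_mul a b hx)
    obtain ⟨M, hM, hMx⟩ := hmem _ hx
    refine ⟨M, hM, hMx, ?_⟩
    exact (respects_and_compl_of_add_eq_arcExponent (h𝓕 hM) hMx.symm S (hverts g hg)).1

/-! ### The union bound over the structure theorem -/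

/-- **Union bound.** For `n ≥ 3` and every nonnegative weighting `μ` of the nest-free perfect
matchings of `[2n]` of total mass `1`, some balanced split `S ⊆ [2n]` (`2n < 3|S| ≤ 4n`) is
respected with mass at least `1 / (4 · L(NN_n) · (n+1)²)`, where `L` is the (monotone,
fan-in-two) circuit complexity over `ℝ≥0`: write `NN_n = Σ_t a_t b_t` by the homogeneous
structure theorem, put every matching into the class of a split carrying one of the `a_t b_t`
containing its monomial (`exists_balanced_vertex_split`), and take the heaviest class.
[folklore] -/
theorem exists_balanced_split_of_complexity {n : ℕ} (hn : 3 ≤ n)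
    (μ : (Fin (2 * n) → Fin (2 * n)) → ℝ≥0) (hμ : ∑ M ∈ nestFreeMatchings (2 * n), μ M = 1) :
    ∃ S : Finset (Fin (2 * n)), 2 * n < 3 * S.card ∧ 3 * S.card ≤ 4 * n ∧
      (1 : ℝ≥0) ≤ (4 * complexity (nestFreeMatchingPoly n ℝ≥0) * (n + 1) ^ 2 : ℕ) *
        ∑ M ∈ (nestFreeMatchings (2 * n)).filter (fun M => ∀ i, i ∈ S ↔ M i ∈ S), μ M := by
  classical
  set p := nestFreeMatchingPoly n ℝ≥0 with hp
  set s := complexity p with hs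
  obtain ⟨L, hLlen, hLsum, hL⟩ := exists_homogeneous_balanced_decomposition_of_complexity_le
    (le_refl s) (nestFreeMatchingPoly_isHomogeneous (n := n) (k := ℝ≥0)) hn
  -- the splits attached to the terms
  have hsplit : ∀ t ∈ L, ∃ S : Finset (Fin (2 * n)), 2 * n < 3 * S.card ∧ 3 * S.card ≤ 4 * n ∧
      ∀ x ∈ (t.2.1 * t.2.2).support, ∃ M ∈ nestFreeMatchings (2 * n),
        arcExponent M = x ∧ ∀ i, i ∈ S ↔ M i ∈ S := by
    intro t ht
    obtain ⟨hhom, h1, h2, hne, hle⟩ := hL t ht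
    have hle' : ∀ x, coeff x (t.2.1 * t.2.2) ≤
        coeff x (∑ M ∈ nestFreeMatchings (2 * n), arcMonomial ℝ≥0 M) := by
      intro x
      rw [← nestFreeMatchingPoly_eq_sum_arcMonomial]
      exact hle x
    obtain ⟨S, hScard, hS⟩ := exists_balanced_vertex_split
      nestFreeMatchings_subset_perfectMatchings hhom hne hle'
    exact ⟨S, by omega, by omega, hS⟩
  choose! Sp hSp using hsplit
  -- every nest-free matching lies in the class of some term
  have hcover : ∀ M ∈ nestFreeMatchings (2 * n), ∃ t ∈ L, ∀ i, i ∈ Sp t ↔ M i ∈ Sp t := by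
    intro M hM
    have hx : arcExponent M ∈ p.support := by
      rw [hp, support_nestFreeMatchingPoly, mem_image]
      exact ⟨M, hM, rfl⟩
    have hx' : ∃ t ∈ L, arcExponent M ∈ (t.2.1 * t.2.2).support := by
      by_contra hcon
      push Not at hcon
      rw [mem_support_iff, ← hLsum] at hx
      apply hx
      rw [← coeffAddMonoidHom_apply, map_list_sum]
      apply List.sum_eq_zero
      intro c hc
      rw [List.map_map, List.mem_map] at hc
      obtain ⟨t, ht, rfl⟩ := hc
      simpa [coeffAddMonoidHom_apply, notMem_support_iff] using hcon t ht
    obtain ⟨t, ht, hxt⟩ := hx'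
    obtain ⟨M', hM', hM'x, hresp⟩ := (hSp t ht).2.2 _ hxt
    have hMM' : M' = M := arcExponent_injOn (nestFreeMatchings_subset_perfectMatchings hM')
      (nestFreeMatchings_subset_perfectMatchings hM) hM'x
    subst hMM'
    exact ⟨t, ht, hresp⟩
  -- the union bound
  set T := L.toFinset with hT
  set mass : (ℕ × MvPolynomial (Fin (2 * n) × Fin (2 * n)) ℝ≥0 ×
      MvPolynomial (Fin (2 * n) × Fin (2 * n)) ℝ≥0) → ℝ≥0 := fun t =>
    ∑ M ∈ (nestFreeMatchings (2 * n)).filter (fun M => ∀ i, i ∈ Sp t ↔ M i ∈ Sp t), μ M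
    with hmass
  have hbound : (1 : ℝ≥0) ≤ ∑ t ∈ T, mass t := by
    rw [← hμ]
    have hrw : ∀ t ∈ T, mass t = ∑ M ∈ nestFreeMatchings (2 * n),
        if (∀ i, i ∈ Sp t ↔ M i ∈ Sp t) then μ M else 0 := by
      intro t _
      simp only [hmass]
      rw [sum_filter]
    rw [sum_congr rfl hrw, sum_comm]
    refine sum_le_sum fun M hM => ?_
    obtain ⟨t, ht, hresp⟩ := hcover M hM
    have ht' : t ∈ T := by rw [hT, List.mem_toFinset]; exact ht
    refine le_trans ?_ (single_le_sum (f := fun t => if (∀ i, i ∈ Sp t ↔ M i ∈ Sp t)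
      then μ M else 0) (fun _ _ => zero_le) ht')
    simp only [if_pos hresp, le_refl]
  have hTne : T.Nonempty := by
    rw [nonempty_iff_ne_empty]
    rintro hTe
    rw [hTe, sum_empty] at hbound
    exact absurd hbound (by simp)
  obtain ⟨t₀, ht₀, hmax⟩ := exists_max_image T mass hTne
  have ht₀L : t₀ ∈ L := by rw [hT, List.mem_toFinset] at ht₀; exact ht₀
  refine ⟨Sp t₀, (hSp t₀ ht₀L).1, (hSp t₀ ht₀L).2.1, ?_⟩
  calc (1 : ℝ≥0) ≤ ∑ t ∈ T, mass t := hbound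
    _ ≤ ∑ _t ∈ T, mass t₀ := sum_le_sum hmax
    _ = (T.card : ℝ≥0) * mass t₀ := by rw [sum_const, nsmul_eq_mul]
    _ ≤ ((4 * s * (n + 1) ^ 2 : ℕ) : ℝ≥0) * mass t₀ := by
        gcongr
        exact_mod_cast (List.toFinset_card_le (l := L)).trans hLlen

/-! ### The reduction -/

/-- **`NNMonotoneHard` from spread measures.** If for every exponent `c` there are `n ≥ 3` and a
probability weighting `μ` of the nest-free perfect matchings of `[2n]` under which EVERY balanced
split `S ⊆ [2n]` (`2n < 3|S| ≤ 4n`) is respected with mass `μ{M : ∀ i, i ∈ S ↔ M i ∈ S}` so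
small that `4 (n^c + c) (n+1)² · mass < 1`, then the nest-free matching polynomials are not
p-computable over `ℝ≥0` (route decl `NNMonotoneHard`, verbatim). [folklore] -/
theorem nnMonotoneHard_of_spread_measures
    (h : ∀ c : ℕ, ∃ n : ℕ, 3 ≤ n ∧ ∃ μ : (Fin (2 * n) → Fin (2 * n)) → ℝ≥0,
      (∑ M ∈ nestFreeMatchings (2 * n), μ M = 1) ∧
      ∀ S : Finset (Fin (2 * n)), 2 * n < 3 * S.card → 3 * S.card ≤ 4 * n →
        ((4 * (n ^ c + c) * (n + 1) ^ 2 : ℕ) : ℝ≥0) *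
          (∑ M ∈ (nestFreeMatchings (2 * n)).filter (fun M => ∀ i, i ∈ S ↔ M i ∈ S), μ M) < 1) :
    Summit.ValiantsHypothesis.ValiantsHypothesis.Theses.FifoMatching.NNMonotoneHard := by
  unfold Summit.ValiantsHypothesis.ValiantsHypothesis.Theses.FifoMatching.NNMonotoneHard
  change ¬ IsPComputable (fun n => nestFreeMatchingPoly n ℝ≥0)
  rintro ⟨c, hc⟩
  obtain ⟨n, hn, μ, hμ, hsmall⟩ := h c
  obtain ⟨S, h1, h2, hbig⟩ := exists_balanced_split_of_complexity hn μ hμ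
  have hlt := hsmall S h1 h2
  have hcn : complexity (nestFreeMatchingPoly n ℝ≥0) ≤ n ^ c + c := hc n
  have hmono : ((4 * complexity (nestFreeMatchingPoly n ℝ≥0) * (n + 1) ^ 2 : ℕ) : ℝ≥0) ≤
      ((4 * (n ^ c + c) * (n + 1) ^ 2 : ℕ) : ℝ≥0) := by
    exact_mod_cast Nat.mul_le_mul_right _ (Nat.mul_le_mul_left _ hcn)
  exact absurd (lt_of_le_of_lt (hbig.trans (mul_le_mul_of_nonneg_right hmono zero_le)) hlt)
    (lt_irrefl _)

end Summit.ValiantsHypothesis.ValiantsHypothesis.Theorems.FifoMatching.NNMonotoneHard
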